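import Summits.BirchSwinnertonDyer.BirchSwinnertonDyer.Theorems.EisensteinPrimesGoodLatticeBDPValueOfNamedFactsV23
import Summits.BirchSwinnertonDyer.BirchSwinnertonDyer.Theorems.EisensteinPrimesGoodLatticeBDPValueT4OfCyclotomic
import Literature.NumberTheory.EllipticCurves.KellerYin2024.AnomalousCongruenceFullDescentDatum
import Literature.NumberTheory.IwasawaTheory.WeakLeopoldtCyclotomic
import HarnessLib
/-!
# Crux `GoodLatticeBDPValue` (stmt-BirchSwinnertonDyer-19032), line `halves`: THE CRUX BY NAME AS A CONDITIONAL KERNEL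
# THEOREM ON THIRTEEN LITERATURE NAMED FACTS AND NOTHING ELSE (the v24 surface)

Cell `bsd-eis` (run/shared/lean/pub/bsd-eis/), LEAD seat `bsd-line-x1-p1` gen 7. `--supports stmt-BirchSwinnertonDyer-19032`.
Two bookkeeping moves on top of LEAD gen 6's `GoodLatticeBDPValueOfNamedFactsV23.goodLatticeBDPValue_of_namedFacts₂₃` (p664468:
the crux from the four v23 stub statements — twelve published named facts ∧ the inline statement 3a-A):

* **3a-A BY NAME.** The registered statement of stub 3a-A `stub_anacongOfFullDescentDatum` ([AN] at every odd `p` GIVEN a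
  full-descent datum) is now the Literature named fact
  `Literature.NumberTheory.EllipticCurves.KellerYin2024.thm222_anacong_goodLattice_of_fullDescentDatum`
  (`Literature/NumberTheory/EllipticCurves/KellerYin2024/AnomalousCongruenceFullDescentDatum.lean`, p666692, LEAD gen 7; token for
  token the stub's text; composed of refereed print in the filer's reading — Kriz 2016 Thm. 3 with Def. 31 (5) / Thm. 34 (3) /
  Thm. 35 ∘ CGLS 2022 Thms. 2.2.1/2.2.2 ∘ Hida 2010 Thm. I —, referee C3's ruling on the label pending), so the second hypothesis
  below is that NAME (the `def` unfolds to the v23 text definitionally).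
* **(T4) ↦ its cyclotomic case.** Width seat w2 gen 7 proved in the kernel that Greenberg's open-subgroup weak Leopoldt (T4)
  `Greenberg2006.weakLeopoldt_H2_subsingleton_above_cyclotomic_of_isOpen` is EQUIVALENT to Iwasawa's cyclotomic weak Leopoldt
  `IwasawaTheory.weakLeopoldt_H2_subsingleton_cyclotomic_of_isOpen` (NSW (10.3.25) with (10.3.22); p665557 / p665558,
  `GoodLatticeBDPValueT4OfCyclotomic.above_cyclotomic_of_cyclotomic` / `cyclotomic_of_above_cyclotomic`); stub 4's second conjunct
  is therefore stated as the TEXTBOOK theorem's name (count-neutral; the by-name surface gains print-faithfulness, and it is the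
  exact target of width seat w8 gen 8's discharge lane).

Result: `goodLatticeBDPValue_of_namedFacts₂₄ : ⟨stub 1: five PUB⟩ → thm222_anacong_goodLattice_of_fullDescentDatum →
⟨prop411 ∧ cycWL ∧ (∀ L, tateGlobalEulerPoincareCharacteristic L) ∧ (∀ L, poitouTate_restricted_three_le L)⟩ →
⟨prop263 ∧ thm222_…_of_five_le ∧ thm212⟩ → Theses.EisensteinPrimes.GoodLatticeBDPValue` — the crux BY NAME conditional on
exactly THIRTEEN Literature named facts (research: CGLS 2022 proof of Thm. 4.2.2, Thm. 5.1.3 (disc), Thm. 2.1.2; Bleher et al. 2020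
Thm. 3.3.1; de Shalit 1987 II.6.4; Hida 2010 Thm. I; Greenberg 2016 Props. 4.1.1, 2.6.3; the two composed-print KellerYin2024
siblings `_of_five_le` / `_of_fullDescentDatum`; textbook: NSW (10.3.25) cyclotomic weak Leopoldt, Milne ADT I Thm. 5.1, Harari
Thm. 17.13 (a)) and on NO inline statement. HONEST FRAMING: a CONDITIONAL theorem (audit `proof.conditional`, thirteen names);
it closes nothing; no summit statement / BSD / KY Thm. 2.2.2 / the crux is proved here; 0 cells / labels move; the label of
`_of_fullDescentDatum` is under referee review (a relabel to claim-grade would make the crux's preprint surface exactly that name).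
References: those of p664468, p665558, p666692 and of the v23 skeleton `Cruxes/GoodLatticeBDPValue/Lines/halves.lean`.
-/

-- `Summit.BirchSwinnertonDyer.BirchSwinnertonDyer.…`: the summit and its single sub-problem share a name (D-0017 layout).
set_option linter.dupNamespace false
set_option autoImplicit false

namespace Summit.BirchSwinnertonDyer.BirchSwinnertonDyer.Theorems.GoodLatticeBDPValueOfNamedFactsV24

open scoped Classical

open PowerSeries WeierstrassCurve NumberField IsDedekindDomain Field
  Literature.NumberTheory.GaloisRepresentations Literature.NumberTheory.EllipticCurves.GreenbergVatsal2000
  Summit.BirchSwinnertonDyer.BirchSwinnertonDyer.Theorems.EisensteinPrimesMuLambda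
  Literature.NumberTheory.EllipticCurves Literature.NumberTheory.EllipticCurves.ModularForms
  Literature.NumberTheory.EllipticCurves.Rank1Residual Literature.NumberTheory.EllipticCurves.Castella2018
  Literature.NumberTheory.EllipticCurves.GreenbergSelmer Literature.NumberTheory.QuadraticFields
  Literature.NumberTheory.EllipticCurves.CastellaGrossiLeeSkinner2022
  Literature.NumberTheory.EllipticCurves.KellerYin2024 Literature.NumberTheory.EllipticCurves.IwasawaAlgebra
  Literature.NumberTheory.EllipticCurves.Rubin1991 Literature.NumberTheory.EllipticCurves.DeShalit1987
  Literature.NumberTheory.EllipticCurves.Hida2010MuInvariant Literature.NumberTheory.EllipticCurves.BCGKPST2020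
open Literature.NumberTheory.IwasawaTheory Literature.NumberTheory.IwasawaTheory.Greenberg2016
  Literature.NumberTheory.IwasawaTheory.Greenberg2006
open Summit.BirchSwinnertonDyer.BirchSwinnertonDyer.Theorems

/-- **THE CRUX BY NAME — `Theses.EisensteinPrimes.GoodLatticeBDPValue` — from THIRTEEN LITERATURE NAMED FACTS (the v24 surface)**:
stub 1's five BDP / CM facts; 3a-A as the named fact `KellerYin2024.thm222_anacong_goodLattice_of_fullDescentDatum` (p666692);
stub 4 with Iwasawa's CYCLOTOMIC weak Leopoldt in place of (T4); stub 4b unchanged — by LEAD gen 6's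
`GoodLatticeBDPValueOfNamedFactsV23.goodLatticeBDPValue_of_namedFacts₂₃` (p664468) after rebuilding its stub-4 hypothesis with
`above_cyclotomic_of_cyclotomic` (p665558); the 3a-A hypothesis is passed as is (the Literature `def` unfolds to the registered
v21–v23 text). CONDITIONAL on exactly these thirteen names; closes nothing by itself; BSD is proved for no curve.
[claim: KellerYin2024, status: under-review]
[cite: KellerYin2024, Thm. 3.0.8 (IMC2) and proof (arXiv:2402.12781v2 TeX L1631–1640), Thm. 1.4.1, proof of Thm. 1.5.1, Thms. 2.2.1–2.2.3]
[cite: CastellaGrossiLeeSkinner2022, proof of Thm. 4.2.2, Thm. 5.1.3 with (disc), Thm. 2.1.2, Thms. 2.2.1/2.2.2 with (2.16), proof of Thm. 1.5.1, Prop. 1.2.5]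
[cite: Kriz2016, Thm. 3, Def. 31 (5), Rem. 33, Thm. 34 (3), Thm. 35] [cite: BleherEtAl2020, §3.3 Thm. 3.3.1] [cite: deShalit1987, II.6.4 Theorem (i)]
[cite: Hida2010MuInvariant, Thm. I] [cite: Greenberg2016Selmer, Prop. 4.1.1, Prop. 2.6.3] [cite: NeukirchSchmidtWingberg2008, (10.3.25) with (10.3.22)]
[cite: MilneADT2006, I Thm. 5.1] [cite: Harari2020, Thm. 17.13 (a)] [cite: PollackWeston2011, App. A Prop. A.2] -/
theorem goodLatticeBDPValue_of_namedFacts₂₄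
    (stub_publishedFacts :
      proofThm422_exists_isBDPLFunction_isTorsion_charIdeal_dvd ∧
        thm513_exists_isBDPLFunction_valueAtOne_disc ∧
        thm331_rubin_exists_katzMeasure₂_pseudoIso_span_eq ∧
        thmII64_katzMeasure₂_functionalEquation ∧
        thmI_mu_katzBranch_reflect_eq_zero)
    (stub_anacongOfFullDescentDatum : thm222_anacong_goodLattice_of_fullDescentDatum)
    (stub_publishedFactsGreenberg :
      prop411_selmer_isAlmostDivisible ∧
        Literature.NumberTheory.IwasawaTheory.weakLeopoldt_H2_subsingleton_cyclotomic_of_isOpen ∧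
        (∀ (L : Type) [Field L] [NumberField L], Literature.NumberTheory.GaloisCohomology.tateGlobalEulerPoincareCharacteristic L) ∧
        (∀ (L : Type) [Field L] [NumberField L], Literature.NumberTheory.GaloisCohomology.poitouTate_restricted_three_le L))
    (stub_publishedFactsMore :
      prop263_sur_of_crk ∧ thm222_anacong_goodLattice_of_five_le ∧ thm212_exists_isKatzLFunction) :
    Summit.BirchSwinnertonDyer.BirchSwinnertonDyer.Theses.EisensteinPrimes.GoodLatticeBDPValue :=
  GoodLatticeBDPValueOfNamedFactsV23.goodLatticeBDPValue_of_namedFacts₂₃ stub_publishedFacts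
    stub_anacongOfFullDescentDatum
    ⟨stub_publishedFactsGreenberg.1,
      GoodLatticeBDPValueT4OfCyclotomic.above_cyclotomic_of_cyclotomic stub_publishedFactsGreenberg.2.1,
      stub_publishedFactsGreenberg.2.2.1, stub_publishedFactsGreenberg.2.2.2⟩
    stub_publishedFactsMore

end Summit.BirchSwinnertonDyer.BirchSwinnertonDyer.Theorems.GoodLatticeBDPValueOfNamedFactsV24
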